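import Mathlib

/-!
# TropicalLinks / InductiveStep — the centre of a valuation ring on a subring it contains

Route `ResolutionOfSingularities/TropicalLinks`, crux `InductiveStep` (stmt-ResolutionOfSingularities-17233),
line `split`, brick CE (producer), in support of stage 1 of the geometric producer
`stub_valuativeCharts`.

Let `K` be a field, `C ⊆ K` a subring (in the route: the coordinate ring of an affine chart of the
projective closure `Ȳ`, a subring of the function field) and `V` a valuation ring of `K` with
`C ⊆ V`.  The **centre** of `V` on `C` is the prime ideal `𝔭 = C ∩ 𝔪_V`, i.e. the elements of `C`
of `V`-valuation `< 1`.  The local ring `C_𝔭` (fractions `a / s` with `s ∉ 𝔭`) lies in `V` and is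
dominated by it: `a / s ∈ 𝔪_V` iff `a ∈ 𝔭`.

* `tropicalLinks_centre_of_valuationSubring` — existence of the centre `𝔭` with exactly these four
  properties (prime; membership = valuation `< 1`; `a / s ∈ V` for `s ∉ 𝔭`; domination).

Proof: `𝔭` is the preimage of the maximal ideal of `V` under the inclusion `C → V`, hence prime;
membership is `ValuationSubring.valuation_lt_one_iff`.  For `s ∉ 𝔭` we have `v s = 1` (it is `≤ 1`
as `s ∈ V` and not `< 1`), so `v (a / s) = v a ≤ 1`, giving `a / s ∈ V`, and `v (a / s) < 1 ↔ v a < 1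
↔ a ∈ 𝔭`.  Mathlib only.
-/

-- single-problem summit: the doubled namespace component `ResolutionOfSingularities` is forced
set_option linter.dupNamespace false

namespace Summit.ResolutionOfSingularities.ResolutionOfSingularities.Theorems

/-- **The centre of a valuation ring on a subring it contains.** For a field `K`, a subring
`C ⊆ K` and a valuation subring `V` of `K` with `C ⊆ V`, there is a prime ideal `𝔭 ⊆ C` (the centre
`C ∩ 𝔪_V`) such that: `c ∈ 𝔭 ↔ v c < 1` for the valuation `v` of `V`; every fraction `a / s` with
`a, s ∈ C`, `s ∉ 𝔭` lies in `V`; and such a fraction has valuation `< 1` iff `a ∈ 𝔭` (so `V`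
dominates the local ring `C_𝔭`). [folklore] -/
theorem tropicalLinks_centre_of_valuationSubring :
    ∀ (K : Type) [Field K] (C : Subring K) (V : ValuationSubring K), C ≤ V.toSubring → ∃ 𝔭 : Ideal ↥C, 𝔭.IsPrime ∧ (∀ c : ↥C, c ∈ 𝔭 ↔ V.valuation (c : K) < 1) ∧ (∀ (a s : ↥C), s ∉ 𝔭 → (a : K) / (s : K) ∈ V) ∧ (∀ (a s : ↥C), s ∉ 𝔭 → (V.valuation ((a : K) / (s : K)) < 1 ↔ a ∈ 𝔭)) := by
  intro K _ C V hCV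
  -- the inclusion `C → V` as a ring hom (the carrier of `↥V` is that of `V.toSubring`)
  let ι : ↥C →+* ↥V :=
    { toFun := fun c => ⟨(c : K), hCV c.2⟩
      map_one' := rfl
      map_mul' := fun _ _ => rfl
      map_zero' := rfl
      map_add' := fun _ _ => rfl }
  -- the centre: preimage of the maximal ideal of `V`
  let 𝔭 : Ideal ↥C := Ideal.comap ι (IsLocalRing.maximalIdeal ↥V)
  have hmem : ∀ c : ↥C, c ∈ 𝔭 ↔ V.valuation (c : K) < 1 := by
    intro c
    change ι c ∈ IsLocalRing.maximalIdeal ↥V ↔ _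
    rw [ValuationSubring.valuation_lt_one_iff]
    rfl
  -- off the centre the valuation is `1`, so dividing by such an element does not change it
  have hval : ∀ a s : ↥C, s ∉ 𝔭 → V.valuation ((a : K) / (s : K)) = V.valuation (a : K) := by
    intro a s hs
    rw [hmem, not_lt] at hs
    have hs1 : V.valuation (s : K) = 1 :=
      le_antisymm ((V.valuation_le_one_iff _).2 (hCV s.2)) hs
    rw [map_div₀, hs1, div_one]
  refine ⟨𝔭, Ideal.comap_isPrime ι _, hmem, fun a s hs => ?_, fun a s hs => ?_⟩
  · rw [← V.valuation_le_one_iff, hval a s hs]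
    exact (V.valuation_le_one_iff _).2 (hCV a.2)
  · rw [hval a s hs, hmem]

end Summit.ResolutionOfSingularities.ResolutionOfSingularities.Theorems
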